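import Literature.NumberTheory.LFunctions.ZetaZeroSumsLehmanExplicit
import Literature.Analysis.SpecialFunctions.LogPiBounds
import HarnessLib

/-!
# RH-FREE — `Σ_{γ>T} log(γ/2π)/γ² ≤ (L²−L)/(2πT)` (`T ≥ 4πe`) and `Σ_{γ>T} log²(γ/2π)/γ² ≤ (L³−1.39L²)/(2πT)` (`T ≥ 100`): Brent–Platt–Trudgian 2022, Lemmas 6–7, PROVED from `|N(T) − L(T)| ≤ 0.28 log T` («nothing here bears on the truth of RH»)

Topic `Literature/NumberTheory/LFunctions` (RH literature-typing tranche 1, L4 "explicit zero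
statistics", gen 3: explicit LOG-WEIGHTED tail sums over the ordinates of the zeros of `ζ`, the
second and third entries of the Brent–Platt–Trudgian table of Lehman-type bounds; its first entry,
Lemma 5 `Σ_{γ>T} 1/γ² ≤ L/(2πT)`, is `BrentPlattTrudgian2022_cor1.sum_inv_sq_le` in
`ZetaZeroSumsLehmanExplicit.lean`). Label: **RH-FREE** — unconditional statements about the
ordinates `γ` only. THEOREMS only: no definition, no new named fact; everything is proved from
Lehman's lemma (`lehman_sum_le`, proved in the tree) and the one named fact
`Literature.NumberTheory.LFunctions.BrentPlattTrudgian2022_cor1` (`|N(T) − L(T)| ≤ 0.28 log T`,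
`T ≥ 2π`), taken as a hypothesis `(h : BrentPlattTrudgian2022_cor1)`. Nothing here bears on the
truth of RH.

Source: R. P. Brent, D. J. Platt, T. S. Trudgian, *The mean square of the error term in the prime
number theorem*, J. Number Theory 238 (2022) 740–762 = arXiv:2008.06140, §2 "Preliminary results"
("The results in this section are unconditional") `[corpus:paper:arxiv-2008.06140 p0004]`, with
`L = log T`, `L̂ = log(T/2π)`, `A ≤ 0.28` the constant of their Corollary 1:

* **Lemma 6.** "If `T ≥ 4πe`, then `Σ_{γ>T} log(γ/2π)/γ² ≤ (L² − L)/(2πT)`." Printed proof: Lehman's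
  lemma with `φ(t) = log(t/2π)/t²` (decreasing on `[4πe, ∞)`), the integrals `I₂` and
  `T²∫_T^∞ log t/t³ = (2L+1)/4`, giving the displayed
  `(L̂² + 2L̂ + 2)/(2πT) + Aϑ(2LL̂/T² + (2L̂+1)/(4T²)) ≤ (L² − L)/(2πT)`,
  "where the final inequality uses `T ≥ 4πe` and `A ≤ 0.28`".
* **Lemma 7.** "If `T ≥ 100`, then `Σ_{γ>T} log²(γ/2π)/γ² ≤ (L³ − 1.39L²)/(2πT)`." Printed proof:
  `φ(t) = log²(t/2π)/t²` (decreasing on `[100, ∞)`), the integrals `I₃` and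
  `T²∫_T^∞ log² t/t³ = (2L²+2L+1)/4`, giving
  `(L̂³ + 3L̂² + 6L̂ + 6)/(2πT) + Aϑ((8LL̂² + 2L̂² + 2L̂ + 1)/(4T²)) ≤ (L³ − 1.39L²)/(2πT)`.

As for Lemma 5 in `ZetaZeroSumsLehmanExplicit.lean`, the tail sums are typed in the
finite-truncation form `Σ_{T<γ≤U} m(ρ) φ(γ) ≤ bound(T)` for EVERY `U ≥ T` (ordinates with
multiplicity, the tree's `zerosBetween T U` and `riemannZetaZeroOrder`), which is equivalent to
the printed bound on the infinite sum, the terms being non-negative.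

## Proved here (no new hypotheses beyond `(h : BrentPlattTrudgian2022_cor1)`)

* the four elementary integrals `∫_T^U log²(t/2π)/t²`, `∫_T^U log(t/2π)/t³`, `∫_T^U log³(t/2π)/t²`,
  `∫_T^U log²(t/2π)/t³` in closed form (the source's `I₂`, `I₃`, `(2L+1)/4`, `(2L²+2L+1)/4`, in the
  variable `L̂`, with the `U`-end kept);
* `sum_log_div_sq_le_of_count`, `sum_log_sq_div_sq_le_of_count` — the `A`-explicit displayed lines of
  the two proofs, for any `A` with `|N − L| ≤ A log t` (`t ≥ 2π`) and every `T ≥ 2πe` (where both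
  test functions are already non-increasing);
* `BrentPlattTrudgian2022_cor1.sum_log_div_sq_le` (**Lemma 6**, `T ≥ 4πe`) and
  `BrentPlattTrudgian2022_cor1.sum_log_sq_div_sq_le` (**Lemma 7**, `T ≥ 100`), the printed bounds,
  by the final numerical inequalities: writing `T = T₀e^u` (`u ≥ 0`, `T₀ = 4πe` resp. `100`), both
  sides become polynomials in `u` whose coefficients are compared using `T ≥ T₀(1+u)`,
  `log 2`, `e`, `π` to nine places (Mathlib) and `log π`, `log 10` by kernel interval enclosures
  (`Literature.Analysis.SpecialFunctions.Real.log_pi_gt_d20`, `MI.logNat2`). The margins at the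
  printed thresholds are `1.7%` (Lemma 6 at `4πe`) and `5.6%` (Lemma 7 at `100`) of the remainder.

## References

* R. P. Brent, D. J. Platt, T. S. Trudgian, J. Number Theory 238 (2022) 740–762, §2, Lemmas 2,
  6, 7 and Cor. 1. [BrentPlattTrudgian2022]
* R. S. Lehman, Acta Arith. 11 (1966) 397–410, Lemma (partial summation against `N`). [Lehman1966]
-/

noncomputable section

open Complex Filter Set MeasureTheory intervalIntegral
open scoped Real

namespace Literature.NumberTheory.LFunctions

open SchoenfeldBound

/-! ## Elementary integrals (`I₂`, `I₃` and the two `t⁻³` integrals of the source, with the `U`-end kept) -/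

/-- `d/dt log(t/2π) = 1/t` (`t > 0`). [cite: BrentPlattTrudgian2022, §2 (integrals I_k)] -/
theorem hasDerivAt_log_div_two_pi {t : ℝ} (ht : 0 < t) :
    HasDerivAt (fun s : ℝ ↦ Real.log (s / (2 * π))) (1 / t) t := by
  have h2π : (0 : ℝ) < 2 * π := by positivity
  have h1 : HasDerivAt (fun s : ℝ ↦ s / (2 * π)) (1 / (2 * π)) t := by
    simpa using (hasDerivAt_id t).div_const (2 * π)
  have h2 := (Real.hasDerivAt_log (div_pos ht h2π).ne').comp t h1
  have e : (t / (2 * π))⁻¹ * (1 / (2 * π)) = 1 / t := by field_simp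
  rw [e] at h2
  exact h2

/-- Continuity of `t ↦ log^k(t/2π)/t^n` on `[T, U]`, `T > 0`. [cite: BrentPlattTrudgian2022, §2 (integrals I_k)] -/
theorem continuousOn_log_pow_div_pow {T U : ℝ} (hT : 0 < T) (k n : ℕ) :
    ContinuousOn (fun t : ℝ ↦ Real.log (t / (2 * π)) ^ k / t ^ n) (Icc T U) := by
  intro t ht
  have ht0 : 0 < t := hT.trans_le ht.1
  have hne : (fun x : ℝ ↦ x ^ n) t ≠ 0 := by simp only [ne_eq]; positivity
  exact ((((Real.continuousAt_log (by positivity)).comp (continuousAt_id.div_const _)).pow k).div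
    (continuousAt_id.pow n) hne).continuousWithinAt

/-- `∫_T^U log²(t/2π)/t² dt = (L̂² + 2L̂ + 2)/T − (L̂_U² + 2L̂_U + 2)/U` (`0 < T ≤ U`; the source's `I₂`).
[cite: BrentPlattTrudgian2022, §2 (integrals I_k)] -/
theorem integral_log_sq_div_sq {T U : ℝ} (hT : 0 < T) (hTU : T ≤ U) :
    ∫ t in T..U, Real.log (t / (2 * π)) ^ 2 / t ^ 2 =
      (Real.log (T / (2 * π)) ^ 2 + 2 * Real.log (T / (2 * π)) + 2) / T
        - (Real.log (U / (2 * π)) ^ 2 + 2 * Real.log (U / (2 * π)) + 2) / U := by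
  have hIcc : uIcc T U = Icc T U := uIcc_of_le hTU
  have hF : ∀ t ∈ uIcc T U, HasDerivAt
      (fun s : ℝ ↦ -(Real.log (s / (2 * π)) * Real.log (s / (2 * π)) + 2 * Real.log (s / (2 * π)) + 2) * s⁻¹)
      (Real.log (t / (2 * π)) ^ 2 / t ^ 2) t := by
    intro t ht
    rw [hIcc] at ht
    have ht0 : 0 < t := hT.trans_le ht.1
    have hl := hasDerivAt_log_div_two_pi ht0
    have hG := ((hl.mul hl).add (hl.const_mul 2)).add_const (2 : ℝ)
    have h := hG.neg.mul (hasDerivAt_inv ht0.ne')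
    refine h.congr_deriv ?_
    simp only [Pi.add_apply, Pi.mul_apply, Pi.neg_apply]
    field_simp
    ring
  rw [integral_eq_sub_of_hasDerivAt hF ((continuousOn_log_pow_div_pow hT 2 2).intervalIntegrable_of_Icc hTU)]
  have hT' : T ≠ 0 := hT.ne'
  have hU' : U ≠ 0 := (hT.trans_le hTU).ne'
  field_simp
  ring

/-- `∫_T^U log(t/2π)/t³ dt = (2L̂ + 1)/(4T²) − (2L̂_U + 1)/(4U²)` (`0 < T ≤ U`).
[cite: BrentPlattTrudgian2022, §2 (eq. after I_k, "(2L+1)/4")] -/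
theorem integral_log_div_cube {T U : ℝ} (hT : 0 < T) (hTU : T ≤ U) :
    ∫ t in T..U, Real.log (t / (2 * π)) ^ 1 / t ^ 3 =
      (2 * Real.log (T / (2 * π)) + 1) / (4 * T ^ 2)
        - (2 * Real.log (U / (2 * π)) + 1) / (4 * U ^ 2) := by
  have hIcc : uIcc T U = Icc T U := uIcc_of_le hTU
  have hF : ∀ t ∈ uIcc T U, HasDerivAt
      (fun s : ℝ ↦ -(2 * Real.log (s / (2 * π)) + 1) * (s⁻¹ * s⁻¹ / 4))
      (Real.log (t / (2 * π)) ^ 1 / t ^ 3) t := by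
    intro t ht
    rw [hIcc] at ht
    have ht0 : 0 < t := hT.trans_le ht.1
    have hl := hasDerivAt_log_div_two_pi ht0
    have hG := (hl.const_mul 2).add_const (1 : ℝ)
    have hI := ((hasDerivAt_inv ht0.ne').mul (hasDerivAt_inv ht0.ne')).div_const 4
    have h := hG.neg.mul hI
    refine h.congr_deriv ?_
    simp only [Pi.mul_apply, Pi.neg_apply]
    field_simp
    ring
  rw [integral_eq_sub_of_hasDerivAt hF ((continuousOn_log_pow_div_pow hT 1 3).intervalIntegrable_of_Icc hTU)]
  have hT' : T ≠ 0 := hT.ne'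
  have hU' : U ≠ 0 := (hT.trans_le hTU).ne'
  field_simp
  ring

/-- `∫_T^U log³(t/2π)/t² dt = (L̂³ + 3L̂² + 6L̂ + 6)/T − (same at U)/U` (`0 < T ≤ U`; the source's `I₃`).
[cite: BrentPlattTrudgian2022, §2 (integrals I_k)] -/
theorem integral_log_cube_div_sq {T U : ℝ} (hT : 0 < T) (hTU : T ≤ U) :
    ∫ t in T..U, Real.log (t / (2 * π)) ^ 3 / t ^ 2 =
      (Real.log (T / (2 * π)) ^ 3 + 3 * Real.log (T / (2 * π)) ^ 2 + 6 * Real.log (T / (2 * π)) + 6) / T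
        - (Real.log (U / (2 * π)) ^ 3 + 3 * Real.log (U / (2 * π)) ^ 2 + 6 * Real.log (U / (2 * π)) + 6) / U := by
  have hIcc : uIcc T U = Icc T U := uIcc_of_le hTU
  have hF : ∀ t ∈ uIcc T U, HasDerivAt
      (fun s : ℝ ↦ -(Real.log (s / (2 * π)) * Real.log (s / (2 * π)) * Real.log (s / (2 * π))
          + 3 * (Real.log (s / (2 * π)) * Real.log (s / (2 * π))) + 6 * Real.log (s / (2 * π)) + 6) * s⁻¹)
      (Real.log (t / (2 * π)) ^ 3 / t ^ 2) t := by
    intro t ht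
    rw [hIcc] at ht
    have ht0 : 0 < t := hT.trans_le ht.1
    have hl := hasDerivAt_log_div_two_pi ht0
    have hG := ((((hl.mul hl).mul hl).add ((hl.mul hl).const_mul 3)).add (hl.const_mul 6)).add_const (6 : ℝ)
    have h := hG.neg.mul (hasDerivAt_inv ht0.ne')
    refine h.congr_deriv ?_
    simp only [Pi.add_apply, Pi.mul_apply, Pi.neg_apply]
    field_simp
    ring
  rw [integral_eq_sub_of_hasDerivAt hF ((continuousOn_log_pow_div_pow hT 3 2).intervalIntegrable_of_Icc hTU)]
  have hT' : T ≠ 0 := hT.ne'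
  have hU' : U ≠ 0 := (hT.trans_le hTU).ne'
  field_simp
  ring

/-- `∫_T^U log²(t/2π)/t³ dt = (2L̂² + 2L̂ + 1)/(4T²) − (same at U)/(4U²)` (`0 < T ≤ U`).
[cite: BrentPlattTrudgian2022, §2 (eq. after I_k, "(2L²+2L+1)/4")] -/
theorem integral_log_sq_div_cube {T U : ℝ} (hT : 0 < T) (hTU : T ≤ U) :
    ∫ t in T..U, Real.log (t / (2 * π)) ^ 2 / t ^ 3 =
      (2 * Real.log (T / (2 * π)) ^ 2 + 2 * Real.log (T / (2 * π)) + 1) / (4 * T ^ 2)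
        - (2 * Real.log (U / (2 * π)) ^ 2 + 2 * Real.log (U / (2 * π)) + 1) / (4 * U ^ 2) := by
  have hIcc : uIcc T U = Icc T U := uIcc_of_le hTU
  have hF : ∀ t ∈ uIcc T U, HasDerivAt
      (fun s : ℝ ↦ -(2 * (Real.log (s / (2 * π)) * Real.log (s / (2 * π))) + 2 * Real.log (s / (2 * π)) + 1)
          * (s⁻¹ * s⁻¹ / 4))
      (Real.log (t / (2 * π)) ^ 2 / t ^ 3) t := by
    intro t ht
    rw [hIcc] at ht
    have ht0 : 0 < t := hT.trans_le ht.1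
    have hl := hasDerivAt_log_div_two_pi ht0
    have hG := (((hl.mul hl).const_mul 2).add (hl.const_mul 2)).add_const (1 : ℝ)
    have hI := ((hasDerivAt_inv ht0.ne').mul (hasDerivAt_inv ht0.ne')).div_const 4
    have h := hG.neg.mul hI
    refine h.congr_deriv ?_
    simp only [Pi.add_apply, Pi.mul_apply, Pi.neg_apply]
    field_simp
    ring
  rw [integral_eq_sub_of_hasDerivAt hF ((continuousOn_log_pow_div_pow hT 2 3).intervalIntegrable_of_Icc hTU)]
  have hT' : T ≠ 0 := hT.ne'
  have hU' : U ≠ 0 := (hT.trans_le hTU).ne'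
  field_simp
  ring

/-! ## The `A`-explicit bounds (the displayed lines of the two proofs) -/

/-- `A ≥ 0` for any admissible constant (`log T > 0` at `T = 2π`). [cite: BrentPlattTrudgian2022, Cor. 1] -/
private theorem count_const_nonneg {A : ℝ}
    (hA : ∀ t : ℝ, 2 * π ≤ t → |(zetaZeroCount t : ℝ) - countMain t| ≤ A * Real.log t) : 0 ≤ A := by
  have hπ : 3 < π := Real.pi_gt_three
  have h1 := hA (2 * π) le_rfl
  have hlog : 0 < Real.log (2 * π) := Real.log_pos (by linarith)
  have : 0 ≤ A * Real.log (2 * π) := (abs_nonneg _).trans h1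
  nlinarith

/-- `log(t/2π) ≥ 1` for `t ≥ 2πe`. [folklore] -/
private theorem one_le_log_div_two_pi {t : ℝ} (ht : 2 * π * Real.exp 1 ≤ t) :
    1 ≤ Real.log (t / (2 * π)) := by
  have h2π : (0 : ℝ) < 2 * π := by positivity
  have h : Real.exp 1 ≤ t / (2 * π) := by rw [le_div_iff₀ h2π]; linarith
  have := Real.log_le_log (Real.exp_pos 1) h
  rwa [Real.log_exp] at this

/-- **The `A`-explicit form of Brent–Platt–Trudgian 2022, Lemma 6** (the displayed line of its
proof): if `|N(t) − L(t)| ≤ A log t` for `t ≥ 2π`, then for `2πe ≤ T ≤ U`,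
`Σ_{T<γ≤U} m(ρ) log(γ/2π)/γ² ≤ (L̂² + 2L̂ + 2)/(2πT) + A(2LL̂/T² + (2L̂+1)/(4T²))`
(`L = log T`, `L̂ = log(T/2π)`; Lehman's lemma with `φ(t) = log(t/2π)/t²`, which is non-increasing
on `[2π√e, ∞) ⊇ [2πe, ∞)`, dropping the negative `U`-terms).
[cite: BrentPlattTrudgian2022, Lemma 6 (proof)] -/
theorem sum_log_div_sq_le_of_count {A T U : ℝ}
    (hA : ∀ t : ℝ, 2 * π ≤ t → |(zetaZeroCount t : ℝ) - countMain t| ≤ A * Real.log t)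
    (hT : 2 * π * Real.exp 1 ≤ T) (hTU : T ≤ U) :
    ∑ ρ ∈ zerosBetween T U, (riemannZetaZeroOrder ρ : ℝ) * (Real.log (ρ.im / (2 * π)) / ρ.im ^ 2) ≤
      (Real.log (T / (2 * π)) ^ 2 + 2 * Real.log (T / (2 * π)) + 2) / (2 * π * T)
        + A * (2 * Real.log T * Real.log (T / (2 * π)) / T ^ 2
            + (2 * Real.log (T / (2 * π)) + 1) / (4 * T ^ 2)) := by
  have hπ : 3 < π := Real.pi_gt_three
  have h2π : (0 : ℝ) < 2 * π := by positivity
  have he : 1 ≤ Real.exp 1 := by linarith [Real.add_one_le_exp (1 : ℝ)]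
  have hT2π : 2 * π ≤ T := le_trans (by nlinarith) hT
  have hT0 : 0 < T := by linarith
  have hU0 : 0 < U := hT0.trans_le hTU
  have hA0 : 0 ≤ A := count_const_nonneg hA
  have hℓ1 : ∀ t ∈ Icc T U, 1 ≤ Real.log (t / (2 * π)) := fun t ht ↦
    one_le_log_div_two_pi (hT.trans ht.1)
  -- Lehman with φ(t) = log(t/2π)/t²
  have hφ : ∀ t ∈ Icc T U, HasDerivAt (fun s : ℝ ↦ Real.log (s / (2 * π)) / s ^ 2)
      ((1 - 2 * Real.log (t / (2 * π))) / t ^ 3) t := by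
    intro t ht
    have ht0 : 0 < t := hT0.trans_le ht.1
    have hl := hasDerivAt_log_div_two_pi ht0
    have hd : HasDerivAt (fun s : ℝ ↦ s ^ 2) (2 * t) t := by simpa using hasDerivAt_pow 2 t
    have h := hl.div hd (by positivity : t ^ 2 ≠ 0)
    refine h.congr_deriv ?_
    field_simp
  have hφ' : ContinuousOn (fun t : ℝ ↦ (1 - 2 * Real.log (t / (2 * π))) / t ^ 3) (Icc T U) := by
    intro t ht
    have ht0 : 0 < t := hT0.trans_le ht.1
    have hne : (fun x : ℝ ↦ x ^ 3) t ≠ 0 := by simp only [ne_eq]; positivity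
    exact ((continuousAt_const.sub (((Real.continuousAt_log (by positivity)).comp
      (continuousAt_id.div_const _)).const_mul 2)).div (continuousAt_id.pow 3) hne).continuousWithinAt
  have hφ'0 : ∀ t ∈ Icc T U, (1 - 2 * Real.log (t / (2 * π))) / t ^ 3 ≤ 0 := fun t ht ↦ by
    have ht0 : 0 < t := hT0.trans_le ht.1
    have := hℓ1 t ht
    exact div_nonpos_of_nonpos_of_nonneg (by linarith) (by positivity)
  have hℓU : 1 ≤ Real.log (U / (2 * π)) := hℓ1 U ⟨hTU, le_rfl⟩
  have hφU : 0 ≤ Real.log (U / (2 * π)) / U ^ 2 := div_nonneg (by linarith) (by positivity)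
  have hL := lehman_sum_le hA hT2π hTU hφ hφ' hφ'0 hφU
  have e1 : ∫ t in T..U, Real.log (t / (2 * π)) / t ^ 2 * Real.log (t / (2 * π)) =
      ∫ t in T..U, Real.log (t / (2 * π)) ^ 2 / t ^ 2 :=
    intervalIntegral.integral_congr fun t _ ↦ by ring
  have e2 : ∫ t in T..U, Real.log (t / (2 * π)) / t ^ 2 / t =
      ∫ t in T..U, Real.log (t / (2 * π)) ^ 1 / t ^ 3 :=
    intervalIntegral.integral_congr fun t _ ↦ by ring
  rw [e1, e2, integral_log_sq_div_sq hT0 hTU, integral_log_div_cube hT0 hTU] at hL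
  -- drop the (negative) `U`-terms
  have d1 : 0 ≤ (Real.log (U / (2 * π)) ^ 2 + 2 * Real.log (U / (2 * π)) + 2) / U := by positivity
  have d2 : 0 ≤ (2 * Real.log (U / (2 * π)) + 1) / (4 * U ^ 2) := by positivity
  have s1 : ((Real.log (T / (2 * π)) ^ 2 + 2 * Real.log (T / (2 * π)) + 2) / T
      - (Real.log (U / (2 * π)) ^ 2 + 2 * Real.log (U / (2 * π)) + 2) / U) / (2 * π) ≤
      (Real.log (T / (2 * π)) ^ 2 + 2 * Real.log (T / (2 * π)) + 2) / (2 * π * T) := by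
    rw [div_le_iff₀ h2π]
    have : (Real.log (T / (2 * π)) ^ 2 + 2 * Real.log (T / (2 * π)) + 2) / (2 * π * T) * (2 * π) =
        (Real.log (T / (2 * π)) ^ 2 + 2 * Real.log (T / (2 * π)) + 2) / T := by
      field_simp
    rw [this]
    linarith
  have s2 : A * (2 * (Real.log (T / (2 * π)) / T ^ 2) * Real.log T
      + ((2 * Real.log (T / (2 * π)) + 1) / (4 * T ^ 2) - (2 * Real.log (U / (2 * π)) + 1) / (4 * U ^ 2))) ≤
      A * (2 * Real.log T * Real.log (T / (2 * π)) / T ^ 2 + (2 * Real.log (T / (2 * π)) + 1) / (4 * T ^ 2)) := by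
    apply mul_le_mul_of_nonneg_left _ hA0
    have : 2 * (Real.log (T / (2 * π)) / T ^ 2) * Real.log T =
        2 * Real.log T * Real.log (T / (2 * π)) / T ^ 2 := by ring
    linarith
  linarith

/-- **The `A`-explicit form of Brent–Platt–Trudgian 2022, Lemma 7** (the displayed line of its
proof): if `|N(t) − L(t)| ≤ A log t` for `t ≥ 2π`, then for `2πe ≤ T ≤ U`,
`Σ_{T<γ≤U} m(ρ) log²(γ/2π)/γ² ≤ (L̂³ + 3L̂² + 6L̂ + 6)/(2πT) + A(2LL̂²/T² + (2L̂² + 2L̂ + 1)/(4T²))`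
(`= … + A(8LL̂² + 2L̂² + 2L̂ + 1)/(4T²)` as printed; Lehman's lemma with `φ(t) = log²(t/2π)/t²`,
non-increasing on `[2πe, ∞)`, dropping the negative `U`-terms).
[cite: BrentPlattTrudgian2022, Lemma 7 (proof)] -/
theorem sum_log_sq_div_sq_le_of_count {A T U : ℝ}
    (hA : ∀ t : ℝ, 2 * π ≤ t → |(zetaZeroCount t : ℝ) - countMain t| ≤ A * Real.log t)
    (hT : 2 * π * Real.exp 1 ≤ T) (hTU : T ≤ U) :
    ∑ ρ ∈ zerosBetween T U, (riemannZetaZeroOrder ρ : ℝ) * (Real.log (ρ.im / (2 * π)) ^ 2 / ρ.im ^ 2) ≤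
      (Real.log (T / (2 * π)) ^ 3 + 3 * Real.log (T / (2 * π)) ^ 2 + 6 * Real.log (T / (2 * π)) + 6)
          / (2 * π * T)
        + A * (2 * Real.log T * Real.log (T / (2 * π)) ^ 2 / T ^ 2
            + (2 * Real.log (T / (2 * π)) ^ 2 + 2 * Real.log (T / (2 * π)) + 1) / (4 * T ^ 2)) := by
  have hπ : 3 < π := Real.pi_gt_three
  have h2π : (0 : ℝ) < 2 * π := by positivity
  have he : 1 ≤ Real.exp 1 := by linarith [Real.add_one_le_exp (1 : ℝ)]
  have hT2π : 2 * π ≤ T := le_trans (by nlinarith) hT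
  have hT0 : 0 < T := by linarith
  have hU0 : 0 < U := hT0.trans_le hTU
  have hA0 : 0 ≤ A := count_const_nonneg hA
  have hℓ1 : ∀ t ∈ Icc T U, 1 ≤ Real.log (t / (2 * π)) := fun t ht ↦
    one_le_log_div_two_pi (hT.trans ht.1)
  -- Lehman with φ(t) = log²(t/2π)/t²
  have hφ : ∀ t ∈ Icc T U, HasDerivAt (fun s : ℝ ↦ Real.log (s / (2 * π)) ^ 2 / s ^ 2)
      (2 * Real.log (t / (2 * π)) * (1 - Real.log (t / (2 * π))) / t ^ 3) t := by
    intro t ht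
    have ht0 : 0 < t := hT0.trans_le ht.1
    have hl := hasDerivAt_log_div_two_pi ht0
    have hd : HasDerivAt (fun s : ℝ ↦ s ^ 2) (2 * t) t := by simpa using hasDerivAt_pow 2 t
    have h := (hl.pow 2).div hd (by positivity : t ^ 2 ≠ 0)
    refine h.congr_deriv ?_
    simp only [Pi.pow_apply]
    field_simp
    ring
  have hφ' : ContinuousOn (fun t : ℝ ↦ 2 * Real.log (t / (2 * π)) * (1 - Real.log (t / (2 * π))) / t ^ 3)
      (Icc T U) := by
    intro t ht
    have ht0 : 0 < t := hT0.trans_le ht.1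
    have hne : (fun x : ℝ ↦ x ^ 3) t ≠ 0 := by simp only [ne_eq]; positivity
    have hlc : ContinuousAt (fun x : ℝ ↦ Real.log (x / (2 * π))) t :=
      (Real.continuousAt_log (by positivity)).comp (continuousAt_id.div_const _)
    exact (((hlc.const_mul 2).mul (continuousAt_const.sub hlc)).div (continuousAt_id.pow 3)
      hne).continuousWithinAt
  have hφ'0 : ∀ t ∈ Icc T U, 2 * Real.log (t / (2 * π)) * (1 - Real.log (t / (2 * π))) / t ^ 3 ≤ 0 :=
    fun t ht ↦ by
    have ht0 : 0 < t := hT0.trans_le ht.1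
    have h1 := hℓ1 t ht
    apply div_nonpos_of_nonpos_of_nonneg _ (by positivity)
    nlinarith
  have hℓU : 1 ≤ Real.log (U / (2 * π)) := hℓ1 U ⟨hTU, le_rfl⟩
  have hφU : 0 ≤ Real.log (U / (2 * π)) ^ 2 / U ^ 2 := by positivity
  have hL := lehman_sum_le hA hT2π hTU hφ hφ' hφ'0 hφU
  have e1 : ∫ t in T..U, Real.log (t / (2 * π)) ^ 2 / t ^ 2 * Real.log (t / (2 * π)) =
      ∫ t in T..U, Real.log (t / (2 * π)) ^ 3 / t ^ 2 :=
    intervalIntegral.integral_congr fun t _ ↦ by ring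
  have e2 : ∫ t in T..U, Real.log (t / (2 * π)) ^ 2 / t ^ 2 / t =
      ∫ t in T..U, Real.log (t / (2 * π)) ^ 2 / t ^ 3 :=
    intervalIntegral.integral_congr fun t _ ↦ by ring
  rw [e1, e2, integral_log_cube_div_sq hT0 hTU, integral_log_sq_div_cube hT0 hTU] at hL
  have d1 : 0 ≤ (Real.log (U / (2 * π)) ^ 3 + 3 * Real.log (U / (2 * π)) ^ 2
      + 6 * Real.log (U / (2 * π)) + 6) / U := by positivity
  have d2 : 0 ≤ (2 * Real.log (U / (2 * π)) ^ 2 + 2 * Real.log (U / (2 * π)) + 1) / (4 * U ^ 2) := by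
    positivity
  have s1 : ((Real.log (T / (2 * π)) ^ 3 + 3 * Real.log (T / (2 * π)) ^ 2 + 6 * Real.log (T / (2 * π)) + 6) / T
      - (Real.log (U / (2 * π)) ^ 3 + 3 * Real.log (U / (2 * π)) ^ 2 + 6 * Real.log (U / (2 * π)) + 6) / U)
        / (2 * π) ≤
      (Real.log (T / (2 * π)) ^ 3 + 3 * Real.log (T / (2 * π)) ^ 2 + 6 * Real.log (T / (2 * π)) + 6)
        / (2 * π * T) := by
    rw [div_le_iff₀ h2π]
    have : (Real.log (T / (2 * π)) ^ 3 + 3 * Real.log (T / (2 * π)) ^ 2 + 6 * Real.log (T / (2 * π)) + 6)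
        / (2 * π * T) * (2 * π) =
        (Real.log (T / (2 * π)) ^ 3 + 3 * Real.log (T / (2 * π)) ^ 2 + 6 * Real.log (T / (2 * π)) + 6) / T := by
      field_simp
    rw [this]
    linarith
  have s2 : A * (2 * (Real.log (T / (2 * π)) ^ 2 / T ^ 2) * Real.log T
      + ((2 * Real.log (T / (2 * π)) ^ 2 + 2 * Real.log (T / (2 * π)) + 1) / (4 * T ^ 2)
        - (2 * Real.log (U / (2 * π)) ^ 2 + 2 * Real.log (U / (2 * π)) + 1) / (4 * U ^ 2))) ≤
      A * (2 * Real.log T * Real.log (T / (2 * π)) ^ 2 / T ^ 2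
        + (2 * Real.log (T / (2 * π)) ^ 2 + 2 * Real.log (T / (2 * π)) + 1) / (4 * T ^ 2)) := by
    apply mul_le_mul_of_nonneg_left _ hA0
    have : 2 * (Real.log (T / (2 * π)) ^ 2 / T ^ 2) * Real.log T =
        2 * Real.log T * Real.log (T / (2 * π)) ^ 2 / T ^ 2 := by ring
    linarith
  linarith

/-! ## Numerical lemmas for the final inequalities -/

/-- `log 100` to nine places, by the kernel interval logarithm (`MI.logNat2`, scale `2^100`,
110 terms): the test `4605170185·2^100 < A.lo·10^9 ∧ A.hi·10^9 < 4605170186·2^100` for the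
enclosure `A ∋ 2^100 log 100` passes. [folklore] -/
private theorem logHundred_check :
    (match Literature.Analysis.ValidatedNumerics.NumericsMP.MI.logNat2
        Literature.Analysis.SpecialFunctions.logPiScale 110 100 with
      | some A => decide (4605170185 * (Literature.Analysis.SpecialFunctions.logPiScale : ℤ) < A.lo * 10 ^ 9 ∧
          A.hi * 10 ^ 9 < 4605170186 * (Literature.Analysis.SpecialFunctions.logPiScale : ℤ))
      | none => false) = true := by
  decide +kernel

/-- `4.605170185 < log 100 < 4.605170186`. [folklore] -/
private theorem log_hundred_bounds :
    (4.605170185 : ℝ) < Real.log 100 ∧ Real.log 100 < (4.605170186 : ℝ) := by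
  have h := logHundred_check
  split at h
  · rename_i A hA
    rw [decide_eq_true_eq] at h
    obtain ⟨h1, h2⟩ := h
    have hS : (0 : ℝ) < Literature.Analysis.SpecialFunctions.logPiScale := by
      exact_mod_cast Literature.Analysis.SpecialFunctions.logPiScale_pos
    have hm := Literature.Analysis.ValidatedNumerics.NumericsMP.MI.mem_logNat2
      Literature.Analysis.SpecialFunctions.logPiScale_pos hA
    obtain ⟨hm1, hm2⟩ := hm
    push_cast at hm1 hm2
    have h1' : (4605170185 : ℝ) * Literature.Analysis.SpecialFunctions.logPiScale < A.lo * 10 ^ 9 := by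
      exact_mod_cast h1
    have h2' : (A.hi : ℝ) * 10 ^ 9 < 4605170186 * Literature.Analysis.SpecialFunctions.logPiScale := by
      exact_mod_cast h2
    constructor
    · have h3 : (4605170185 : ℝ) * Literature.Analysis.SpecialFunctions.logPiScale <
          Real.log 100 * 10 ^ 9 * Literature.Analysis.SpecialFunctions.logPiScale := by nlinarith
      have h4 := lt_of_mul_lt_mul_right h3 hS.le
      have e : (4.605170185 : ℝ) = 4605170185 / 10 ^ 9 := by norm_num
      rw [e, div_lt_iff₀ (by positivity)]
      exact h4
    · have h3 : Real.log 100 * 10 ^ 9 * Literature.Analysis.SpecialFunctions.logPiScale <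
          (4605170186 : ℝ) * Literature.Analysis.SpecialFunctions.logPiScale := by nlinarith
      have h4 := lt_of_mul_lt_mul_right h3 hS.le
      have e : (4.605170186 : ℝ) = 4605170186 / 10 ^ 9 := by norm_num
      rw [e, lt_div_iff₀ (by positivity)]
      exact h4
  · simp at h

/-- The final inequality of Lemma 6 as a polynomial inequality in `u = log(T/4πe) ≥ 0`:
with `l = log(4πe) ∈ [3.531024246, 3.531024248]`, `m = log 2 + 1 ∈ [1.6931471803, 1.6931471809]`,
`E = e ≥ 2.7182818283`, `0.14(2(l+u)(m+u) + (2(m+u)+1)/4) ≤ E(1+u)((l+u)² − (l+u) − ((m+u)² + 2(m+u) + 2))`.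
[cite: BrentPlattTrudgian2022, Lemma 6 (proof, "the final inequality uses T ≥ 4πe and A ≤ 0.28")] -/
private theorem lemma6_numeric {l m E u : ℝ} (hl₁ : 3.531024246 ≤ l) (hl₂ : l ≤ 3.531024248)
    (hm₁ : 1.6931471803 ≤ m) (hm₂ : m ≤ 1.6931471809) (hE : 2.7182818283 ≤ E) (hu : 0 ≤ u) :
    0.14 * (2 * (l + u) * (m + u) + (2 * (m + u) + 1) / 4) ≤
      E * ((1 + u) * ((l + u) ^ 2 - (l + u) - ((m + u) ^ 2 + 2 * (m + u) + 2))) := by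
  -- the right bracket is `R₀ + R₁u` with `R₀ ≥ 0.68406`, `R₁ = 2(l − m) − 3 ≥ 0.67575`
  have p1 : 0 ≤ (l - 3.531024246) * (l + 3.531024246) := mul_nonneg (by linarith) (by linarith)
  have p2 : 0 ≤ (1.6931471809 - m) * (1.6931471809 + m) := mul_nonneg (by linarith) (by linarith)
  have p3 : 0 ≤ u * (2 * l - 2 * m - 3 - 0.67575) := mul_nonneg hu (by linarith)
  have hR : 0.68406 + 0.67575 * u ≤ (l + u) ^ 2 - (l + u) - ((m + u) ^ 2 + 2 * (m + u) + 2) := by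
    nlinarith [p1, p2, p3]
  -- the left bracket is increasing in `l`, `m`
  have hP : 2 * (l + u) * (m + u) + (2 * (m + u) + 1) / 4 ≤
      2 * (3.531024248 + u) * (1.6931471809 + u) + (2 * (1.6931471809 + u) + 1) / 4 := by
    have h1 : (l + u) * (m + u) ≤ (3.531024248 + u) * (1.6931471809 + u) :=
      mul_le_mul (by linarith) (by linarith) (by linarith) (by linarith)
    linarith
  have h1u : 0 ≤ 1 + u := by linarith
  have hRHS : 2.7182818283 * ((1 + u) * (0.68406 + 0.67575 * u)) ≤
      E * ((1 + u) * ((l + u) ^ 2 - (l + u) - ((m + u) ^ 2 + 2 * (m + u) + 2))) := by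
    have hin := mul_le_mul_of_nonneg_left hR h1u
    have hnn : 0 ≤ (1 + u) * (0.68406 + 0.67575 * u) := by positivity
    exact mul_le_mul hE hin hnn (by linarith)
  have hfin : 0.14 * (2 * (3.531024248 + u) * (1.6931471809 + u) + (2 * (1.6931471809 + u) + 1) / 4) ≤
      2.7182818283 * ((1 + u) * (0.68406 + 0.67575 * u)) := by
    nlinarith [mul_nonneg hu hu]
  linarith

/-- The final inequality of Lemma 7 as a polynomial inequality in `u = log(T/100) ≥ 0`:
with `l = log 100 ∈ [4.605170185, 4.605170186]`, `m = log(100/2π) ∈ [2.7672931183, 2.7672931199]`,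
`p = π ≤ 3.1415926536`,
`0.0056p(2(m+u)²(l+u) + (2(m+u)² + 2(m+u) + 1)/4) ≤ (1+u)((l+u)³ − 1.39(l+u)² − ((m+u)³ + 3(m+u)² + 6(m+u) + 6))`.
[cite: BrentPlattTrudgian2022, Lemma 7 (proof, "the final inequality uses T ≥ 100 and A ≤ 0.28")] -/
private theorem lemma7_numeric {l m p u : ℝ} (hl₁ : 4.605170185 ≤ l) (hl₂ : l ≤ 4.605170186)
    (hm₁ : 2.7672931183 ≤ m) (hm₂ : m ≤ 2.7672931199) (hp : p ≤ 3.1415926536) (hu : 0 ≤ u) :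
    0.0056 * p * (2 * (m + u) ^ 2 * (l + u) + (2 * (m + u) ^ 2 + 2 * (m + u) + 1) / 4) ≤
      (1 + u) * ((l + u) ^ 3 - 1.39 * (l + u) ^ 2 - ((m + u) ^ 3 + 3 * (m + u) ^ 2 + 6 * (m + u) + 6)) := by
  have hl0 : 0 ≤ l := by linarith
  have hm0 : 0 ≤ m := by linarith
  -- `D = D₀ + D₁u + D₂u²` with the three coefficients bounded from below by monomial bounds
  have hD : 1.41683 + 5.2429 * u + 1.12363 * u ^ 2 ≤
      (l + u) ^ 3 - 1.39 * (l + u) ^ 2 - ((m + u) ^ 3 + 3 * (m + u) ^ 2 + 6 * (m + u) + 6) := by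
    have e : (l + u) ^ 3 - 1.39 * (l + u) ^ 2 - ((m + u) ^ 3 + 3 * (m + u) ^ 2 + 6 * (m + u) + 6) =
        (l ^ 3 - 1.39 * l ^ 2 - m ^ 3 - 3 * m ^ 2 - 6 * m - 6)
          + u * (3 * l ^ 2 - 2.78 * l - 3 * m ^ 2 - 6 * m - 6) + u ^ 2 * (3 * l - 4.39 - 3 * m) := by
      ring
    rw [e]
    have h1 : (4.605170185 : ℝ) ^ 3 ≤ l ^ 3 := by gcongr
    have h2 : l ^ 2 ≤ (4.605170186 : ℝ) ^ 2 := by gcongr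
    have h3 : m ^ 3 ≤ (2.7672931199 : ℝ) ^ 3 := by gcongr
    have h4 : m ^ 2 ≤ (2.7672931199 : ℝ) ^ 2 := by gcongr
    have h5 : (4.605170185 : ℝ) ^ 2 ≤ l ^ 2 := by gcongr
    have hD0 : 1.41683 ≤ l ^ 3 - 1.39 * l ^ 2 - m ^ 3 - 3 * m ^ 2 - 6 * m - 6 := by
      nlinarith [h1, h2, h3, h4]
    have hD1 : 5.2429 ≤ 3 * l ^ 2 - 2.78 * l - 3 * m ^ 2 - 6 * m - 6 := by nlinarith [h5, h4]
    have hD2 : 1.12363 ≤ 3 * l - 4.39 - 3 * m := by linarith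
    have hu2 : 0 ≤ u ^ 2 := sq_nonneg u
    nlinarith [mul_le_mul_of_nonneg_left hD1 hu, mul_le_mul_of_nonneg_left hD2 hu2]
  -- the left bracket is increasing in `l`, `m`, `p`
  have hP : 2 * (m + u) ^ 2 * (l + u) + (2 * (m + u) ^ 2 + 2 * (m + u) + 1) / 4 ≤
      2 * (2.7672931199 + u) ^ 2 * (4.605170186 + u)
        + (2 * (2.7672931199 + u) ^ 2 + 2 * (2.7672931199 + u) + 1) / 4 := by
    have hmu : 0 ≤ m + u := by linarith
    have hsq : (m + u) ^ 2 ≤ (2.7672931199 + u) ^ 2 := by gcongr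
    have hprod : (m + u) ^ 2 * (l + u) ≤ (2.7672931199 + u) ^ 2 * (4.605170186 + u) :=
      mul_le_mul hsq (by linarith) (by linarith) (by positivity)
    linarith
  have hPnn : 0 ≤ 2 * (m + u) ^ 2 * (l + u) + (2 * (m + u) ^ 2 + 2 * (m + u) + 1) / 4 := by positivity
  have hK : 0.0056 * p ≤ 0.01759292 := by linarith
  have s1 : 0.0056 * p * (2 * (m + u) ^ 2 * (l + u) + (2 * (m + u) ^ 2 + 2 * (m + u) + 1) / 4) ≤
      0.01759292 * (2 * (2.7672931199 + u) ^ 2 * (4.605170186 + u)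
        + (2 * (2.7672931199 + u) ^ 2 + 2 * (2.7672931199 + u) + 1) / 4) :=
    mul_le_mul hK hP hPnn (by norm_num)
  have s2 : 0.01759292 * (2 * (2.7672931199 + u) ^ 2 * (4.605170186 + u)
        + (2 * (2.7672931199 + u) ^ 2 + 2 * (2.7672931199 + u) + 1) / 4) ≤
      (1 + u) * (1.41683 + 5.2429 * u + 1.12363 * u ^ 2) := by
    nlinarith [mul_nonneg hu hu, mul_nonneg (mul_nonneg hu hu) hu]
  have s3 : (1 + u) * (1.41683 + 5.2429 * u + 1.12363 * u ^ 2) ≤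
      (1 + u) * ((l + u) ^ 3 - 1.39 * (l + u) ^ 2 - ((m + u) ^ 3 + 3 * (m + u) ^ 2 + 6 * (m + u) + 6)) :=
    mul_le_mul_of_nonneg_left hD (by linarith)
  linarith

/-! ## Lemmas 6 and 7 as printed (from Corollary 1, `A = 0.28`) -/

namespace BrentPlattTrudgian2022_cor1

set_option maxHeartbeats 400000 in -- unification of the decimal-constant instance of the `A`-explicit bound is slow
/-- **Brent–Platt–Trudgian 2022, Lemma 6** (proved from Corollary 1): for `T ≥ 4πe` and every
`U ≥ T`, `Σ_{T<γ≤U} m(ρ) log(γ/2π)/γ² ≤ (log²T − log T)/(2πT)` — hence (suprema of non-negative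
partial sums) the printed `Σ_{γ>T} log(γ/2π)/γ² ≤ (L² − L)/(2πT)`. Numerics: with `T = 4πe·e^u`,
`T ≥ 4πe(1+u)` and `lemma6_numeric`. [cite: BrentPlattTrudgian2022, Lemma 6] -/
theorem sum_log_div_sq_le (h : BrentPlattTrudgian2022_cor1) {T U : ℝ}
    (hT : 4 * π * Real.exp 1 ≤ T) (hTU : T ≤ U) :
    ∑ ρ ∈ zerosBetween T U, (riemannZetaZeroOrder ρ : ℝ) * (Real.log (ρ.im / (2 * π)) / ρ.im ^ 2) ≤
      (Real.log T ^ 2 - Real.log T) / (2 * π * T) := by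
  have hπ : 0 < π := Real.pi_pos
  have hπ3 : 3 < π := Real.pi_gt_three
  have he1 : 2.7182818283 < Real.exp 1 := Real.exp_one_gt_d9
  have hl2a : 0.6931471803 < Real.log 2 := Real.log_two_gt_d9
  have hl2b : Real.log 2 < 0.6931471808 := Real.log_two_lt_d9
  have hlπa := Literature.Analysis.SpecialFunctions.Real.log_pi_gt_d20
  have hlπb := Literature.Analysis.SpecialFunctions.Real.log_pi_lt_d20
  obtain ⟨T₀, hT₀⟩ : ∃ T₀ : ℝ, T₀ = 4 * π * Real.exp 1 := ⟨_, rfl⟩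
  have hT₀pos : 0 < T₀ := by rw [hT₀]; positivity
  rw [← hT₀] at hT
  have hT0 : 0 < T := hT₀pos.trans_le hT
  have hT2πe : 2 * π * Real.exp 1 ≤ T :=
    le_trans (by rw [hT₀]; nlinarith [mul_pos hπ (Real.exp_pos 1)]) hT
  have hA : ∀ t : ℝ, 2 * π ≤ t → |(zetaZeroCount t : ℝ) - countMain t| ≤ 0.28 * Real.log t := h
  have h0 := sum_log_div_sq_le_of_count hA hT2πe hTU
  -- the logarithms: `log T = l₀ + u`, `log(T/2π) = m₀ + u`
  obtain ⟨l₀, hl₀⟩ : ∃ l₀ : ℝ, l₀ = 2 * Real.log 2 + Real.log π + 1 := ⟨_, rfl⟩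
  obtain ⟨m₀, hm₀⟩ : ∃ m₀ : ℝ, m₀ = Real.log 2 + 1 := ⟨_, rfl⟩
  have hLT₀ : Real.log T₀ = l₀ := by
    rw [hT₀, hl₀, Real.log_mul (by positivity) (Real.exp_pos 1).ne', Real.log_mul (by norm_num) hπ.ne',
      Real.log_exp, show (4 : ℝ) = 2 ^ 2 by norm_num, Real.log_pow]
    push_cast
    ring
  obtain ⟨u, hu⟩ : ∃ u : ℝ, u = Real.log (T / T₀) := ⟨_, rfl⟩
  have hu0 : 0 ≤ u := by rw [hu]; exact Real.log_nonneg (by rw [le_div_iff₀ hT₀pos]; linarith)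
  have hLl : Real.log T = l₀ + u := by
    rw [hu, Real.log_div hT0.ne' hT₀pos.ne', hLT₀]; ring
  have hℓm : Real.log (T / (2 * π)) = m₀ + u := by
    rw [Real.log_div hT0.ne' (by positivity), Real.log_mul (by norm_num) hπ.ne', hLl, hl₀, hm₀]; ring
  have hTge : T₀ * (1 + u) ≤ T := by
    have hTexp : T = T₀ * Real.exp u := by
      rw [hu, Real.exp_log (div_pos hT0 hT₀pos)]; field_simp
    rw [hTexp]
    exact mul_le_mul_of_nonneg_left (by linarith [Real.add_one_le_exp u]) hT₀pos.le
  have hl₀pos : 0 < l₀ := by rw [hl₀]; linarith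
  have hm₀pos : 0 < m₀ := by rw [hm₀]; linarith
  -- the key numerical inequality
  have key : 0.28 * (2 * Real.log T * Real.log (T / (2 * π)) / T ^ 2
      + (2 * Real.log (T / (2 * π)) + 1) / (4 * T ^ 2)) ≤
      ((Real.log T ^ 2 - Real.log T) - (Real.log (T / (2 * π)) ^ 2 + 2 * Real.log (T / (2 * π)) + 2))
        / (2 * π * T) := by
    rw [hLl, hℓm]
    have eL : 0.28 * (2 * (l₀ + u) * (m₀ + u) / T ^ 2 + (2 * (m₀ + u) + 1) / (4 * T ^ 2)) =
        (0.28 * (2 * π) * (2 * (l₀ + u) * (m₀ + u) + (2 * (m₀ + u) + 1) / 4) / T) / (2 * π * T) := by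
      field_simp
    rw [eL]
    apply div_le_div_of_nonneg_right _ (by positivity)
    have hnum := lemma6_numeric (l := l₀) (m := m₀) (E := Real.exp 1) (u := u)
      (by rw [hl₀]; linarith) (by rw [hl₀]; linarith) (by rw [hm₀]; linarith) (by rw [hm₀]; linarith)
      he1.le hu0
    have h1u : 0 < 1 + u := by linarith
    calc 0.28 * (2 * π) * (2 * (l₀ + u) * (m₀ + u) + (2 * (m₀ + u) + 1) / 4) / T
        ≤ 0.28 * (2 * π) * (2 * (l₀ + u) * (m₀ + u) + (2 * (m₀ + u) + 1) / 4) / (T₀ * (1 + u)) :=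
          div_le_div_of_nonneg_left (by positivity) (by positivity) hTge
      _ = 0.14 * (2 * (l₀ + u) * (m₀ + u) + (2 * (m₀ + u) + 1) / 4) / (Real.exp 1 * (1 + u)) := by
          rw [hT₀]
          field_simp
          ring
      _ ≤ (l₀ + u) ^ 2 - (l₀ + u) - ((m₀ + u) ^ 2 + 2 * (m₀ + u) + 2) := by
          rw [div_le_iff₀ (by positivity)]
          have e2 : ((l₀ + u) ^ 2 - (l₀ + u) - ((m₀ + u) ^ 2 + 2 * (m₀ + u) + 2)) * (Real.exp 1 * (1 + u)) =
              Real.exp 1 * ((1 + u) * ((l₀ + u) ^ 2 - (l₀ + u) - ((m₀ + u) ^ 2 + 2 * (m₀ + u) + 2))) := by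
            ring
          rw [e2]
          exact hnum
  have etot : (Real.log (T / (2 * π)) ^ 2 + 2 * Real.log (T / (2 * π)) + 2) / (2 * π * T)
      + ((Real.log T ^ 2 - Real.log T) - (Real.log (T / (2 * π)) ^ 2 + 2 * Real.log (T / (2 * π)) + 2))
        / (2 * π * T) = (Real.log T ^ 2 - Real.log T) / (2 * π * T) := by
    rw [← add_div]
    ring_nf
  linarith [h0, key, etot]

set_option maxHeartbeats 400000 in -- unification of the decimal-constant instance of the `A`-explicit bound is slow
/-- **Brent–Platt–Trudgian 2022, Lemma 7** (proved from Corollary 1): for `T ≥ 100` and every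
`U ≥ T`, `Σ_{T<γ≤U} m(ρ) log²(γ/2π)/γ² ≤ (log³T − 1.39 log²T)/(2πT)` — hence the printed
`Σ_{γ>T} log²(γ/2π)/γ² ≤ (L³ − 1.39L²)/(2πT)`. Numerics: with `T = 100e^u`, `T ≥ 100(1+u)`,
`log 100` by the kernel enclosure `log_hundred_bounds`, and `lemma7_numeric`.
[cite: BrentPlattTrudgian2022, Lemma 7] -/
theorem sum_log_sq_div_sq_le (h : BrentPlattTrudgian2022_cor1) {T U : ℝ}
    (hT : 100 ≤ T) (hTU : T ≤ U) :
    ∑ ρ ∈ zerosBetween T U, (riemannZetaZeroOrder ρ : ℝ) * (Real.log (ρ.im / (2 * π)) ^ 2 / ρ.im ^ 2) ≤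
      (Real.log T ^ 3 - 1.39 * Real.log T ^ 2) / (2 * π * T) := by
  have hπ : 0 < π := Real.pi_pos
  have hπa : 3.14159265358979323846 < π := Real.pi_gt_d20
  have hπb : π < 3.14159265358979323847 := Real.pi_lt_d20
  have he2 : Real.exp 1 < 2.7182818286 := Real.exp_one_lt_d9
  have hl2a : 0.6931471803 < Real.log 2 := Real.log_two_gt_d9
  have hl2b : Real.log 2 < 0.6931471808 := Real.log_two_lt_d9
  have hlπa := Literature.Analysis.SpecialFunctions.Real.log_pi_gt_d20
  have hlπb := Literature.Analysis.SpecialFunctions.Real.log_pi_lt_d20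
  obtain ⟨hLa, hLb⟩ := log_hundred_bounds
  have hT0 : 0 < T := by linarith
  have hT2πe : 2 * π * Real.exp 1 ≤ T := le_trans (by nlinarith) hT
  have hA : ∀ t : ℝ, 2 * π ≤ t → |(zetaZeroCount t : ℝ) - countMain t| ≤ 0.28 * Real.log t := h
  have h0 := sum_log_sq_div_sq_le_of_count hA hT2πe hTU
  -- the logarithms: `log T = l₀ + u`, `log(T/2π) = m₀ + u`
  obtain ⟨l₀, hl₀⟩ : ∃ l₀ : ℝ, l₀ = Real.log 100 := ⟨_, rfl⟩
  obtain ⟨m₀, hm₀⟩ : ∃ m₀ : ℝ, m₀ = Real.log 100 - Real.log 2 - Real.log π := ⟨_, rfl⟩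
  obtain ⟨u, hu⟩ : ∃ u : ℝ, u = Real.log (T / 100) := ⟨_, rfl⟩
  have hu0 : 0 ≤ u := by rw [hu]; exact Real.log_nonneg (by rw [le_div_iff₀ (by norm_num)]; linarith)
  have hLl : Real.log T = l₀ + u := by
    rw [hu, Real.log_div hT0.ne' (by norm_num), hl₀]; ring
  have hℓm : Real.log (T / (2 * π)) = m₀ + u := by
    rw [Real.log_div hT0.ne' (by positivity), Real.log_mul (by norm_num) hπ.ne', hLl, hl₀, hm₀]; ring
  have hTge : 100 * (1 + u) ≤ T := by
    have hTexp : T = 100 * Real.exp u := by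
      rw [hu, Real.exp_log (div_pos hT0 (by norm_num))]; field_simp
    rw [hTexp]
    exact mul_le_mul_of_nonneg_left (by linarith [Real.add_one_le_exp u]) (by norm_num)
  have hl₀pos : 0 < l₀ := by rw [hl₀]; linarith
  have hm₀pos : 0 < m₀ := by rw [hm₀]; linarith
  -- the key numerical inequality
  have key : 0.28 * (2 * Real.log T * Real.log (T / (2 * π)) ^ 2 / T ^ 2
      + (2 * Real.log (T / (2 * π)) ^ 2 + 2 * Real.log (T / (2 * π)) + 1) / (4 * T ^ 2)) ≤
      ((Real.log T ^ 3 - 1.39 * Real.log T ^ 2) - (Real.log (T / (2 * π)) ^ 3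
        + 3 * Real.log (T / (2 * π)) ^ 2 + 6 * Real.log (T / (2 * π)) + 6)) / (2 * π * T) := by
    rw [hLl, hℓm]
    have eL : 0.28 * (2 * (l₀ + u) * (m₀ + u) ^ 2 / T ^ 2
        + (2 * (m₀ + u) ^ 2 + 2 * (m₀ + u) + 1) / (4 * T ^ 2)) =
        (0.28 * (2 * π) * (2 * (m₀ + u) ^ 2 * (l₀ + u) + (2 * (m₀ + u) ^ 2 + 2 * (m₀ + u) + 1) / 4) / T)
          / (2 * π * T) := by
      field_simp
    rw [eL]
    apply div_le_div_of_nonneg_right _ (by positivity)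
    have hnum := lemma7_numeric (l := l₀) (m := m₀) (p := π) (u := u)
      (by rw [hl₀]; linarith) (by rw [hl₀]; linarith) (by rw [hm₀]; linarith) (by rw [hm₀]; linarith)
      (by linarith) hu0
    have h1u : 0 < 1 + u := by linarith
    calc 0.28 * (2 * π) * (2 * (m₀ + u) ^ 2 * (l₀ + u) + (2 * (m₀ + u) ^ 2 + 2 * (m₀ + u) + 1) / 4) / T
        ≤ 0.28 * (2 * π) * (2 * (m₀ + u) ^ 2 * (l₀ + u) + (2 * (m₀ + u) ^ 2 + 2 * (m₀ + u) + 1) / 4)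
            / (100 * (1 + u)) :=
          div_le_div_of_nonneg_left (by positivity) (by positivity) hTge
      _ = 0.0056 * π * (2 * (m₀ + u) ^ 2 * (l₀ + u) + (2 * (m₀ + u) ^ 2 + 2 * (m₀ + u) + 1) / 4)
            / (1 + u) := by
          field_simp
          ring
      _ ≤ (l₀ + u) ^ 3 - 1.39 * (l₀ + u) ^ 2
            - ((m₀ + u) ^ 3 + 3 * (m₀ + u) ^ 2 + 6 * (m₀ + u) + 6) := by
          rw [div_le_iff₀ h1u]
          have e2 : ((l₀ + u) ^ 3 - 1.39 * (l₀ + u) ^ 2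
              - ((m₀ + u) ^ 3 + 3 * (m₀ + u) ^ 2 + 6 * (m₀ + u) + 6)) * (1 + u) =
              (1 + u) * ((l₀ + u) ^ 3 - 1.39 * (l₀ + u) ^ 2
                - ((m₀ + u) ^ 3 + 3 * (m₀ + u) ^ 2 + 6 * (m₀ + u) + 6)) := by
            ring
          rw [e2]
          exact hnum
  have etot : (Real.log (T / (2 * π)) ^ 3 + 3 * Real.log (T / (2 * π)) ^ 2
      + 6 * Real.log (T / (2 * π)) + 6) / (2 * π * T)
      + ((Real.log T ^ 3 - 1.39 * Real.log T ^ 2) - (Real.log (T / (2 * π)) ^ 3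
        + 3 * Real.log (T / (2 * π)) ^ 2 + 6 * Real.log (T / (2 * π)) + 6)) / (2 * π * T) =
      (Real.log T ^ 3 - 1.39 * Real.log T ^ 2) / (2 * π * T) := by
    rw [← add_div]
    ring_nf
  linarith [h0, key, etot]

end BrentPlattTrudgian2022_cor1

end Literature.NumberTheory.LFunctions

end
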